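import Summits.QuantumFields.YangMills.Theorems.LangevinControlUVOSLegsFromFemtoAndGapDefs
import HarnessLib

/-!
# Crux `UVSeamRec` (stmt-QuantumFields-20043) / `NT` (stmt-QuantumFields-19353):
# a PENETRATING EXTERIOR FAMILY refutes every ∀-exterior femto one-point law with depth-decaying tolerance

Fleet lead prover of crux `UVSeamRec` (unit `ym-spine-20043-p1`, g7), finding `FINDING-20043-g7-selfdual.md` (evidence on 20043).
Both registered stubs of the v4-F skeleton are discharged in the tree through ∀-exterior one-point boundary laws with a
`C₁/depth⁴` tolerance — `FBL6` (ceilings: `FBL6 → stub_collar6`), `FBL`/E1-osc (floors: reference / one-cube /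
Markov–mirror currencies; E1-osc = clause 1 of the registered 19353 stub `stub_refpkgT`).  This file isolates, as kernel-checked
implications, the purely logical half of the seat's classical attack (self-dual uniform boundary flux is Bogomolny-protected and
penetrates the cube, kit j273817–j273822): IF some family of (cube, site, pair of exteriors) has a one-point response bounded BELOW
by a fixed `θ > 0` at every large `β`, at sites of arbitrarily large depth (`PlanePenetration` / `DensPenetration` — exactly what
Laplace's principle `Literature.…StatisticalMechanics.tendsto_gibbsAverage_unique_min` (p517756) delivers from the classical statement
«the continuation of the self-dual exterior is the unique action minimiser in the box»), THEN `FBL6 G r a`, `FBL G r a` and the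
E1-osc clause fail for EVERY unit map `a → 0`.  Nothing here asserts the hypothesis; nothing here is a claim about NT, E0′ or the gap.

* `PlanePenetration`, `DensPenetration` — the hypotheses (route-posited Props, explicit; one plane resp. the action density);
* `not_fbl6_of_planePenetration`, `not_fbl_of_densPenetration`, `not_e1osc_of_densPenetration` — the refutations modulo them.
-/

set_option autoImplicit false

noncomputable section

open MeasureTheory Filter Topology
open Literature.MathematicalPhysics.QuantumFieldTheory Literature.MathematicalPhysics.QuantumLattice
open Literature.Probability.LatticeModels
open Summit.QuantumFields.YangMills.Cruxes.OSLegsFromFemtoAndGap.DlrCollarTransfer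

namespace Summit.QuantumFields.YangMills.Cruxes.UVSeamRec.BoundaryLawPenetration

variable (G : Type) [Group G] [TopologicalSpace G] [IsTopologicalGroup G] [CompactSpace G]
  [MeasurableSpace G] [BorelSpace G] (r : LatticeRep G)

/-- **Plane penetration hypothesis.**  There are an orientation `q = (i < j)` and a response floor `θ > 0` such that for every
target depth `d ≥ 1` some cube `(c, b)`, some site `x` of depth `≥ max d 2` in it and two exteriors `η, η'` have, for all large `β`,
`θ ≤ |kerE_Q^η(plane_q x) − kerE_Q^{η'}(plane_q x)|` (β-uniform penetration of the boundary influence to depth `d`).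
The seat's classical witness: `η` = the constant SELF-DUAL abelian flux `U₁ = e^{iBx₀σ₃}, U₃ = e^{iBx₂σ₃}` (any fixed small `B`),
`η'` = the identity exterior, `x` = the centre, `θ = 2(1 − cos B)·(1 − o(1))` by Laplace's principle at the unique minimiser. -/
def PlanePenetration : Prop :=
  ∃ (q : Fin 4 × Fin 4) (θ : ℝ), q.1 < q.2 ∧ 0 < θ ∧ ∀ d : ℕ, 1 ≤ d →
    ∃ (c : Fin 4 → ℤ) (b : ℕ) (x : Fin 4 → ℤ) (η η' : LGConfig 4 G), d ≤ depth c b x ∧ 2 ≤ depth c b x ∧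
      ∃ β₀ : ℝ, ∀ β : ℝ, β₀ ≤ β → θ ≤ |kerE G r β c b η (plane G r q x) - kerE G r β c b η' (plane G r q x)|

/-- **Density penetration hypothesis** — the same for the action density `dens` (sum of the six planes), depth `≥ max d 1`. -/
def DensPenetration : Prop :=
  ∃ θ : ℝ, 0 < θ ∧ ∀ d : ℕ, 1 ≤ d →
    ∃ (c : Fin 4 → ℤ) (b : ℕ) (x : Fin 4 → ℤ) (η η' : LGConfig 4 G), d ≤ depth c b x ∧ 2 ≤ depth c b x ∧
      ∃ β₀ : ℝ, ∀ β : ℝ, β₀ ≤ β → θ ≤ |kerE G r β c b η (dens G r x) - kerE G r β c b η' (dens G r x)|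

variable {G r}

/-- Arithmetic core: for `θ > 0` and any `C` there is a depth `d ≥ 1` with `2·C/d⁴ < θ`. [folklore] -/
theorem exists_depth_small {θ : ℝ} (C : ℝ) (hθ : 0 < θ) : ∃ d : ℕ, 1 ≤ d ∧ 2 * C / (d : ℝ) ^ 4 < θ := by
  obtain ⟨n, hn⟩ := exists_nat_gt (2 * C / θ)
  refine ⟨n + 1, by omega, ?_⟩
  have hn1 : (1 : ℝ) ≤ (n + 1 : ℕ) := by exact_mod_cast Nat.succ_le_succ (Nat.zero_le n)
  have hpos : (0 : ℝ) < ((n + 1 : ℕ) : ℝ) := by positivity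
  have hd4 : ((n + 1 : ℕ) : ℝ) ≤ ((n + 1 : ℕ) : ℝ) ^ 4 := by
    calc ((n + 1 : ℕ) : ℝ) = ((n + 1 : ℕ) : ℝ) ^ 1 := (pow_one _).symm
      _ ≤ ((n + 1 : ℕ) : ℝ) ^ 4 := pow_le_pow_right₀ hn1 (by norm_num)
  have hlt : 2 * C / θ < ((n + 1 : ℕ) : ℝ) := lt_of_lt_of_le hn (by exact_mod_cast Nat.le_succ n)
  have h1 : 2 * C < θ * ((n + 1 : ℕ) : ℝ) := by
    have := (div_lt_iff₀ hθ).1 hlt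
    linarith [this]
  rw [div_lt_iff₀ (by positivity)]
  calc 2 * C < θ * ((n + 1 : ℕ) : ℝ) := h1
    _ ≤ θ * ((n + 1 : ℕ) : ℝ) ^ 4 := mul_le_mul_of_nonneg_left hd4 hθ.le

/-- Femto-ness is eventually automatic for a FIXED cube when `a → 0`: `∃ β₂, ∀ β ≥ β₂, b·a β ≤ ℓ`. [folklore] -/
theorem eventually_femto {a : ℝ → ℝ} (hlim : Tendsto a atTop (𝓝 0)) (b : ℕ) {ℓ : ℝ} (hℓ : 0 < ℓ) :
    ∃ β₂ : ℝ, ∀ β : ℝ, β₂ ≤ β → (b : ℝ) * a β ≤ ℓ := by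
  have hev : ∀ᶠ β in atTop, a β < ℓ / ((b : ℝ) + 1) :=
    (tendsto_order.1 hlim).2 _ (by positivity)
  obtain ⟨β₂, hβ₂⟩ := eventually_atTop.1 hev
  refine ⟨β₂, fun β hβ => ?_⟩
  have h := hβ₂ β hβ
  have hb0 : (0 : ℝ) ≤ b := Nat.cast_nonneg b
  by_cases ha : 0 ≤ a β
  · calc (b : ℝ) * a β ≤ ((b : ℝ) + 1) * a β := mul_le_mul_of_nonneg_right (by linarith) ha
      _ ≤ ((b : ℝ) + 1) * (ℓ / ((b : ℝ) + 1)) := mul_le_mul_of_nonneg_left h.le (by positivity)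
      _ = ℓ := by field_simp
  · push Not at ha
    have : (b : ℝ) * a β ≤ 0 := mul_nonpos_of_nonneg_of_nonpos hb0 ha.le
    linarith

/-- Two exteriors both within `C/D⁴` of a common reference are within `2C/d⁴` of each other when `d ≤ D`, `1 ≤ d`. [folklore] -/
theorem abs_sub_le_of_common_ref {u u' p C : ℝ} {d D : ℕ} (hd : 1 ≤ d) (hdD : d ≤ D) (hC : 0 ≤ C)
    (hu : |u - p| ≤ C / (D : ℝ) ^ 4) (hu' : |u' - p| ≤ C / (D : ℝ) ^ 4) : |u - u'| ≤ 2 * C / (d : ℝ) ^ 4 := by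
  have hd0 : (0 : ℝ) < d := by exact_mod_cast hd
  have hmono : C / (D : ℝ) ^ 4 ≤ C / (d : ℝ) ^ 4 := by
    apply div_le_div_of_nonneg_left hC (by positivity)
    exact pow_le_pow_left₀ hd0.le (by exact_mod_cast hdD) 4
  calc |u - u'| = |(u - p) - (u' - p)| := by ring_nf
    _ ≤ |u - p| + |u' - p| := abs_sub _ _
    _ ≤ C / (d : ℝ) ^ 4 + C / (d : ℝ) ^ 4 := add_le_add (hu.trans hmono) (hu'.trans hmono)
    _ = 2 * C / (d : ℝ) ^ 4 := by ring

/-- **A plane-penetrating family refutes `FBL6` in every unit `a → 0`.** [folklore] -/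
theorem not_fbl6_of_planePenetration (hP : PlanePenetration G r) (a : ℝ → ℝ) (hlim : Tendsto a atTop (𝓝 0)) :
    ¬ FBL6 G r a := by
  rintro ⟨C₁, β₁, ℓ₁, p, hℓ₁, hC₁, hlaw⟩
  obtain ⟨q, θ, hq, hθ, hfam⟩ := hP
  obtain ⟨d, hd1, hdθ⟩ := exists_depth_small C₁ hθ
  obtain ⟨c, b, x, η, η', hdx, h2x, β₀, hresp⟩ := hfam d hd1
  obtain ⟨β₂, hβ₂⟩ := eventually_femto hlim b hℓ₁
  set β : ℝ := max (max β₀ β₁) β₂ with hβ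
  have hb₀ : β₀ ≤ β := le_trans (le_max_left _ _) (le_max_left _ _)
  have hb₁ : β₁ ≤ β := le_trans (le_max_right _ _) (le_max_left _ _)
  have hb₂ : β₂ ≤ β := le_max_right _ _
  have hη := hlaw β hb₁ c b (hβ₂ β hb₂) η q x hq h2x
  have hη' := hlaw β hb₁ c b (hβ₂ β hb₂) η' q x hq h2x
  have hle := abs_sub_le_of_common_ref hd1 hdx hC₁ hη hη'
  have hge := hresp β hb₀
  linarith

/-- **A density-penetrating family refutes `FBL` in every unit `a → 0`.** [folklore] -/
theorem not_fbl_of_densPenetration (hP : DensPenetration G r) (a : ℝ → ℝ) (hlim : Tendsto a atTop (𝓝 0)) :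
    ¬ FBL G r a := by
  rintro ⟨C₁, β₁, ℓ₁, p, hℓ₁, hC₁, hlaw⟩
  obtain ⟨θ, hθ, hfam⟩ := hP
  obtain ⟨d, hd1, hdθ⟩ := exists_depth_small C₁ hθ
  obtain ⟨c, b, x, η, η', hdx, h2x, β₀, hresp⟩ := hfam d hd1
  obtain ⟨β₂, hβ₂⟩ := eventually_femto hlim b hℓ₁
  set β : ℝ := max (max β₀ β₁) β₂ with hβ
  have hb₀ : β₀ ≤ β := le_trans (le_max_left _ _) (le_max_left _ _)
  have hb₁ : β₁ ≤ β := le_trans (le_max_right _ _) (le_max_left _ _)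
  have hb₂ : β₂ ≤ β := le_max_right _ _
  have hη := hlaw β hb₁ c b (hβ₂ β hb₂) η x h2x
  have hη' := hlaw β hb₁ c b (hβ₂ β hb₂) η' x h2x
  have hle := abs_sub_le_of_common_ref hd1 hdx hC₁ hη hη'
  have hge := hresp β hb₀
  linarith

/-- **A density-penetrating family refutes the E1-osc clause** (exterior-OSCILLATION one-point law with tolerance `C₁/depth⁴`,
the shape of `Reference.fbl_of_e1osc`'s hypothesis = clause 1 of the periodic-reference package) for every unit `a → 0`, every
`C₁` and every femto range `ℓ > 0`. [folklore] -/
theorem not_e1osc_of_densPenetration (hP : DensPenetration G r) (a : ℝ → ℝ) (hlim : Tendsto a atTop (𝓝 0))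
    (C₁ ℓ : ℝ) (hℓ : 0 < ℓ) :
    ¬ ∃ β₁ : ℝ, ∀ β : ℝ, β₁ ≤ β → ∀ (c : Fin 4 → ℤ) (b : ℕ), (b : ℝ) * a β ≤ ℓ →
      ∀ (η η' : LGConfig 4 G) (x : Fin 4 → ℤ), 1 ≤ depth c b x →
        |kerE G r β c b η (dens G r x) - kerE G r β c b η' (dens G r x)| ≤ C₁ / (depth c b x : ℝ) ^ 4 := by
  rintro ⟨β₁, hlaw⟩
  obtain ⟨θ, hθ, hfam⟩ := hP
  -- `C₁` may be negative in this shape; then the clause is absurd at once at any deep site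
  by_cases hC₁ : 0 ≤ C₁
  · obtain ⟨d, hd1, hdθ⟩ := exists_depth_small C₁ hθ
    obtain ⟨c, b, x, η, η', hdx, h2x, β₀, hresp⟩ := hfam d hd1
    obtain ⟨β₂, hβ₂⟩ := eventually_femto hlim b hℓ
    set β : ℝ := max (max β₀ β₁) β₂ with hβ
    have hb₀ : β₀ ≤ β := le_trans (le_max_left _ _) (le_max_left _ _)
    have hb₁ : β₁ ≤ β := le_trans (le_max_right _ _) (le_max_left _ _)
    have hb₂ : β₂ ≤ β := le_max_right _ _
    have h1x : 1 ≤ depth c b x := le_trans (by norm_num) h2x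
    have hηη' := hlaw β hb₁ c b (hβ₂ β hb₂) η η' x h1x
    have hd0 : (0 : ℝ) < d := by exact_mod_cast hd1
    have hmono : C₁ / (depth c b x : ℝ) ^ 4 ≤ C₁ / (d : ℝ) ^ 4 := by
      apply div_le_div_of_nonneg_left hC₁ (by positivity)
      exact pow_le_pow_left₀ hd0.le (by exact_mod_cast hdx) 4
    have hge := hresp β hb₀
    have : C₁ / (d : ℝ) ^ 4 ≤ 2 * C₁ / (d : ℝ) ^ 4 := by
      rw [mul_div_assoc]; linarith [div_nonneg hC₁ (pow_nonneg hd0.le 4)]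
    linarith
  · push Not at hC₁
    obtain ⟨c, b, x, η, η', hdx, h2x, β₀, hresp⟩ := hfam 1 le_rfl
    obtain ⟨β₂, hβ₂⟩ := eventually_femto hlim b hℓ
    set β : ℝ := max (max β₀ β₁) β₂ with hβ
    have hb₁ : β₁ ≤ β := le_trans (le_max_right _ _) (le_max_left _ _)
    have hb₂ : β₂ ≤ β := le_max_right _ _
    have h1x : 1 ≤ depth c b x := le_trans (by norm_num) h2x
    have hηη := hlaw β hb₁ c b (hβ₂ β hb₂) η η x h1x
    have hpos : (0 : ℝ) < (depth c b x : ℝ) ^ 4 := by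
      have : (0 : ℝ) < (depth c b x : ℝ) := by exact_mod_cast h1x
      positivity
    have hneg : C₁ / (depth c b x : ℝ) ^ 4 < 0 := div_neg_of_neg_of_pos hC₁ hpos
    have h0 : (0 : ℝ) ≤ |kerE G r β c b η (dens G r x) - kerE G r β c b η (dens G r x)| := abs_nonneg _
    linarith


/-! ## §2 (g7, edition 2) Penetration AT A RATE — the plateau mechanism as a falsifier

Seam-s2's classical analysis (CEILINGS-KERNEL-ANALYSIS-seam-s2.md §2: the non-abelian current sheet costs LINEARLY in the
expelled flux, so partial expulsion is optimal and the interior flux saturates at `B_int ≈ 4c_s/b`) predicts a boundary response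
that DECAYS with the depth, but only like `depth⁻²` — no fixed floor `θ`, hence not `PlanePenetration`, yet still fatal for any
`C₁/depth⁴` law.  `PlanePenetrationAtRate ρ` records a response floor `θ·ρ(depth)` at arbitrarily deep sites; if `ρ(n)·n⁴ → ∞`
(e.g. `ρ n = 1/n²`) it refutes `FBL6` in every unit `a → 0` (`not_fbl6_of_planePenetrationAtRate`); likewise for the density /
E1-osc (`not_fbl_of_densPenetrationAtRate`, `not_e1osc_of_densPenetrationAtRate`).  `ρ ≡ 1` recovers §1.  Nothing asserted. -/

section Rate

variable (G r)

/-- **Plane penetration at rate `ρ`.**  An orientation `q`, a constant `θ > 0`, and for every target depth `d₀` a cube, a site `x` of depth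
`≥ max d₀ 2` and two exteriors whose one-point responses differ, for all large `β`, by at least `θ · ρ (depth x)`.  The plateau mechanism
gives `ρ n = 1/n²`. -/
def PlanePenetrationAtRate (ρ : ℕ → ℝ) : Prop :=
  ∃ (q : Fin 4 × Fin 4) (θ : ℝ), q.1 < q.2 ∧ 0 < θ ∧ ∀ d₀ : ℕ, 1 ≤ d₀ →
    ∃ (c : Fin 4 → ℤ) (b : ℕ) (x : Fin 4 → ℤ) (η η' : LGConfig 4 G), d₀ ≤ depth c b x ∧ 2 ≤ depth c b x ∧
      ∃ β₀ : ℝ, ∀ β : ℝ, β₀ ≤ β →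
        θ * ρ (depth c b x) ≤ |kerE G r β c b η (plane G r q x) - kerE G r β c b η' (plane G r q x)|

/-- **Density penetration at rate `ρ`** (same for `dens`). -/
def DensPenetrationAtRate (ρ : ℕ → ℝ) : Prop :=
  ∃ θ : ℝ, 0 < θ ∧ ∀ d₀ : ℕ, 1 ≤ d₀ →
    ∃ (c : Fin 4 → ℤ) (b : ℕ) (x : Fin 4 → ℤ) (η η' : LGConfig 4 G), d₀ ≤ depth c b x ∧ 2 ≤ depth c b x ∧
      ∃ β₀ : ℝ, ∀ β : ℝ, β₀ ≤ β →
        θ * ρ (depth c b x) ≤ |kerE G r β c b η (dens G r x) - kerE G r β c b η' (dens G r x)|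

variable {G r}

/-- If `ρ(n)·n⁴ → ∞` then beyond some depth `θ·ρ(n)·n⁴` exceeds any constant `K`. [folklore] -/
theorem exists_depth_rate {ρ : ℕ → ℝ} (hρ : Tendsto (fun n : ℕ => ρ n * (n : ℝ) ^ 4) atTop atTop) {θ : ℝ} (hθ : 0 < θ)
    (K : ℝ) : ∃ d₀ : ℕ, 1 ≤ d₀ ∧ ∀ n : ℕ, d₀ ≤ n → K < θ * (ρ n * (n : ℝ) ^ 4) := by
  have hev : ∀ᶠ n : ℕ in atTop, K / θ < ρ n * (n : ℝ) ^ 4 := hρ.eventually (eventually_gt_atTop _)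
  obtain ⟨N, hN⟩ := eventually_atTop.1 hev
  refine ⟨max N 1, le_max_right _ _, fun n hn => ?_⟩
  have h := hN n (le_trans (le_max_left _ _) hn)
  have := (div_lt_iff₀' hθ).1 h
  linarith

/-- The rate `ρ n = 1/n²` (the plateau mechanism) satisfies `ρ(n)·n⁴ = n² → ∞`. [folklore] -/
theorem tendsto_inv_sq_mul_pow_four : Tendsto (fun n : ℕ => (1 / (n : ℝ) ^ 2) * (n : ℝ) ^ 4) atTop atTop := by
  have h : ∀ n : ℕ, 1 ≤ n → (1 / (n : ℝ) ^ 2) * (n : ℝ) ^ 4 = (n : ℝ) ^ 2 := by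
    intro n hn
    have : (n : ℝ) ≠ 0 := by exact_mod_cast (Nat.one_le_iff_ne_zero.1 hn)
    field_simp
  refine (tendsto_atTop_atTop.2 fun M => ?_)
  obtain ⟨N, hN⟩ := exists_nat_ge (max M 1)
  refine ⟨max N 1, fun n hn => ?_⟩
  have hn1 : 1 ≤ n := le_trans (le_max_right _ _) hn
  rw [h n hn1]
  have hnM : max M 1 ≤ (n : ℝ) := le_trans hN (by exact_mod_cast le_trans (le_max_left _ _) hn)
  have hn0 : (1 : ℝ) ≤ n := by exact_mod_cast hn1
  calc M ≤ max M 1 := le_max_left _ _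
    _ ≤ (n : ℝ) := hnM
    _ = (n : ℝ) ^ 1 := (pow_one _).symm
    _ ≤ (n : ℝ) ^ 2 := pow_le_pow_right₀ hn0 (by norm_num)

/-- **Penetration at a rate with `ρ(n)·n⁴ → ∞` refutes `FBL6` in every unit `a → 0`.** [folklore] -/
theorem not_fbl6_of_planePenetrationAtRate {ρ : ℕ → ℝ} (hρ : Tendsto (fun n : ℕ => ρ n * (n : ℝ) ^ 4) atTop atTop)
    (hP : PlanePenetrationAtRate G r ρ) (a : ℝ → ℝ) (hlim : Tendsto a atTop (𝓝 0)) : ¬ FBL6 G r a := by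
  rintro ⟨C₁, β₁, ℓ₁, p, hℓ₁, hC₁, hlaw⟩
  obtain ⟨q, θ, hq, hθ, hfam⟩ := hP
  obtain ⟨d₀, hd₀, hbig⟩ := exists_depth_rate hρ hθ (2 * C₁)
  obtain ⟨c, b, x, η, η', hdx, h2x, β₀, hresp⟩ := hfam d₀ hd₀
  obtain ⟨β₂, hβ₂⟩ := eventually_femto hlim b hℓ₁
  set β : ℝ := max (max β₀ β₁) β₂ with hβ
  have hb₀ : β₀ ≤ β := le_trans (le_max_left _ _) (le_max_left _ _)
  have hb₁ : β₁ ≤ β := le_trans (le_max_right _ _) (le_max_left _ _)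
  have hb₂ : β₂ ≤ β := le_max_right _ _
  have hη := hlaw β hb₁ c b (hβ₂ β hb₂) η q x hq h2x
  have hη' := hlaw β hb₁ c b (hβ₂ β hb₂) η' q x hq h2x
  set D : ℕ := depth c b x with hD
  have hD1 : 1 ≤ D := le_trans hd₀ hdx
  have hle := abs_sub_le_of_common_ref hD1 le_rfl hC₁ hη hη'
  have hge := hresp β hb₀
  have hK := hbig D hdx
  -- θ ρ(D) ≤ |Δ| ≤ 2C₁/D⁴ but θ ρ(D) D⁴ > 2C₁
  have hDpos : (0 : ℝ) < (D : ℝ) ^ 4 := by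
    have : (0 : ℝ) < D := by exact_mod_cast hD1
    positivity
  have h1 : θ * ρ D ≤ 2 * C₁ / (D : ℝ) ^ 4 := le_trans hge hle
  have h2 : θ * ρ D * (D : ℝ) ^ 4 ≤ 2 * C₁ := by
    have := mul_le_mul_of_nonneg_right h1 hDpos.le
    rwa [div_mul_cancel₀ _ hDpos.ne'] at this
  have h3 : θ * (ρ D * (D : ℝ) ^ 4) = θ * ρ D * (D : ℝ) ^ 4 := by ring
  linarith

/-- **… refutes `FBL`.** [folklore] -/
theorem not_fbl_of_densPenetrationAtRate {ρ : ℕ → ℝ} (hρ : Tendsto (fun n : ℕ => ρ n * (n : ℝ) ^ 4) atTop atTop)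
    (hP : DensPenetrationAtRate G r ρ) (a : ℝ → ℝ) (hlim : Tendsto a atTop (𝓝 0)) : ¬ FBL G r a := by
  rintro ⟨C₁, β₁, ℓ₁, p, hℓ₁, hC₁, hlaw⟩
  obtain ⟨θ, hθ, hfam⟩ := hP
  obtain ⟨d₀, hd₀, hbig⟩ := exists_depth_rate hρ hθ (2 * C₁)
  obtain ⟨c, b, x, η, η', hdx, h2x, β₀, hresp⟩ := hfam d₀ hd₀
  obtain ⟨β₂, hβ₂⟩ := eventually_femto hlim b hℓ₁
  set β : ℝ := max (max β₀ β₁) β₂ with hβ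
  have hb₀ : β₀ ≤ β := le_trans (le_max_left _ _) (le_max_left _ _)
  have hb₁ : β₁ ≤ β := le_trans (le_max_right _ _) (le_max_left _ _)
  have hb₂ : β₂ ≤ β := le_max_right _ _
  have hη := hlaw β hb₁ c b (hβ₂ β hb₂) η x h2x
  have hη' := hlaw β hb₁ c b (hβ₂ β hb₂) η' x h2x
  set D : ℕ := depth c b x with hD
  have hD1 : 1 ≤ D := le_trans hd₀ hdx
  have hle := abs_sub_le_of_common_ref hD1 le_rfl hC₁ hη hη'
  have hge := hresp β hb₀
  have hK := hbig D hdx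
  have hDpos : (0 : ℝ) < (D : ℝ) ^ 4 := by
    have : (0 : ℝ) < D := by exact_mod_cast hD1
    positivity
  have h1 : θ * ρ D ≤ 2 * C₁ / (D : ℝ) ^ 4 := le_trans hge hle
  have h2 : θ * ρ D * (D : ℝ) ^ 4 ≤ 2 * C₁ := by
    have := mul_le_mul_of_nonneg_right h1 hDpos.le
    rwa [div_mul_cancel₀ _ hDpos.ne'] at this
  have h3 : θ * (ρ D * (D : ℝ) ^ 4) = θ * ρ D * (D : ℝ) ^ 4 := by ring
  linarith

/-- **… refutes the E1-osc clause** (oscillation law with tolerance `C₁/depth⁴`, any `C₁`, any femto range `ℓ > 0`). [folklore] -/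
theorem not_e1osc_of_densPenetrationAtRate {ρ : ℕ → ℝ} (hρ : Tendsto (fun n : ℕ => ρ n * (n : ℝ) ^ 4) atTop atTop)
    (hP : DensPenetrationAtRate G r ρ) (a : ℝ → ℝ) (hlim : Tendsto a atTop (𝓝 0)) (C₁ ℓ : ℝ) (hℓ : 0 < ℓ) :
    ¬ ∃ β₁ : ℝ, ∀ β : ℝ, β₁ ≤ β → ∀ (c : Fin 4 → ℤ) (b : ℕ), (b : ℝ) * a β ≤ ℓ →
      ∀ (η η' : LGConfig 4 G) (x : Fin 4 → ℤ), 1 ≤ depth c b x →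
        |kerE G r β c b η (dens G r x) - kerE G r β c b η' (dens G r x)| ≤ C₁ / (depth c b x : ℝ) ^ 4 := by
  rintro ⟨β₁, hlaw⟩
  obtain ⟨θ, hθ, hfam⟩ := hP
  obtain ⟨d₀, hd₀, hbig⟩ := exists_depth_rate hρ hθ C₁
  obtain ⟨c, b, x, η, η', hdx, h2x, β₀, hresp⟩ := hfam d₀ hd₀
  obtain ⟨β₂, hβ₂⟩ := eventually_femto hlim b hℓ
  set β : ℝ := max (max β₀ β₁) β₂ with hβ
  have hb₀ : β₀ ≤ β := le_trans (le_max_left _ _) (le_max_left _ _)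
  have hb₁ : β₁ ≤ β := le_trans (le_max_right _ _) (le_max_left _ _)
  have hb₂ : β₂ ≤ β := le_max_right _ _
  set D : ℕ := depth c b x with hD
  have hD1 : 1 ≤ D := le_trans hd₀ hdx
  have hηη' := hlaw β hb₁ c b (hβ₂ β hb₂) η η' x hD1
  have hge := hresp β hb₀
  have hK := hbig D hdx
  have hDpos : (0 : ℝ) < (D : ℝ) ^ 4 := by
    have : (0 : ℝ) < D := by exact_mod_cast hD1
    positivity
  have h1 : θ * ρ D ≤ C₁ / (D : ℝ) ^ 4 := le_trans hge hηη'
  have h2 : θ * ρ D * (D : ℝ) ^ 4 ≤ C₁ := by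
    have := mul_le_mul_of_nonneg_right h1 hDpos.le
    rwa [div_mul_cancel₀ _ hDpos.ne'] at this
  have h3 : θ * (ρ D * (D : ℝ) ^ 4) = θ * ρ D * (D : ℝ) ^ 4 := by ring
  linarith

/-- `ρ ≡ 1`: penetration at constant rate is `PlanePenetration` (§1), so §2 generalises §1. [folklore] -/
theorem planePenetrationAtRate_one_of_planePenetration (hP : PlanePenetration G r) :
    PlanePenetrationAtRate G r (fun _ => 1) := by
  obtain ⟨q, θ, hq, hθ, hfam⟩ := hP
  refine ⟨q, θ, hq, hθ, fun d₀ hd₀ => ?_⟩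
  obtain ⟨c, b, x, η, η', hdx, h2x, β₀, hresp⟩ := hfam d₀ hd₀
  exact ⟨c, b, x, η, η', hdx, h2x, β₀, fun β hβ => by simpa using hresp β hβ⟩

end Rate

end Summit.QuantumFields.YangMills.Cruxes.UVSeamRec.BoundaryLawPenetration

end
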